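import Summits.QuantumFields.YangMills.Theorems.UnitScaleTiltMinimiserStabilityRegPrOfB8Thm2AtT3Members
import Summits.QuantumFields.YangMills.Theorems.UnitScaleTiltHistoryTailOfExistenceMinimalOrbitV4
import HarnessLib

/-!
# Route `UnitScaleTilt` — THE RUNG LEAF OF RECORD `YM3TorusSU2` FROM ONE NAMED LITERATURE FACT, THE SIBLING CRUX 20520 AND 19936's NODE-O ROW, BY NAME:
# `YM3TorusSU2 ⟸ {B8Thm2AtT3Members, FluctuationComparisonRegPrIntL, ⟨stub_selXsV4DataRows⟩}` (★ ym-ust-19200-p1 g30 FINAL 22:48Z: «optional one-liner», GO)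

Cell `ym3-torus` (YM ladder rung R3 = continuum `SU(2)` Yang–Mills on T³ — a RUNG, NOT d = 4, NOT infinite volume, NOT a mass gap, NOT Clay); seat `ym-line-cst-p1` g39
(free prover hand); `--supports stmt-QuantumFields-19936 --as helper`, count-neutral, definition-free, default heartbeats; registry ∕ route ∕ display untouched.

WHAT.  After ★★★ director-ym g19's channel (iii) (2026-08-30T22:20Z) the `L = 3` residue of the cone is ONE NAMED LITERATURE FACT: ✓p793328
`Literature.….T3B8Thm2AtMembers.B8Thm2AtT3Members` ([Balaban1985RegularSpaces] Thm 2 at the members of the T³ families, print's big-block setting explicit; (C1) PASS ×2),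
with ✓p793522 `MinimiserStabilityRegPrOfB8Thm2AtT3Members.minimiserStabilityRegPr_of_b8Thm2AtT3Members : B8Thm2AtT3Members → MinimiserStabilityRegPr` (crux 19200 BY NAME)
and `exStub_of_b8Thm2AtT3Members : B8Thm2AtT3Members → ⟨the registry row EX, all L > 1⟩`.  Composing with ✓`historyTailL_of_existenceMinimalOrbit_selXsV4DataRows_allL` (19936
from EX + its NODE-O row) and the route's `closes`:
★★★★ `ym3TorusSU2_of_b8Thm2AtT3Members_intL_selXsV4DataRows (hX : B8Thm2AtT3Members) (h201 : FluctuationComparisonRegPrIntL) (hrows) : YM3TorusSU2` — ONE TERM; also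
`historyTailL_of_b8Thm2AtT3Members_selXsV4DataRows (hX) (hrows) : HistoryTailL` (crux 19936 BY NAME from the fact and its row) and the fixed-block corollary `.at L₀`.
READING: the summit leaf ⟸ {ONE Literature name (debt item, visible-but-unstaffed per RULING №65 (c)), crux 20520, 19936's one registered row} — the gate records the
closure modulo a NAMED fact (D-0014 ∕ D-0026) instead of an anonymous ⟨EX@3⟩ text (cf. ✓p793041, same junction with the text displayed).

HONEST SCOPE (CREDIT NOTHING): a junction of landed theorems; `B8Thm2AtT3Members` (OPEN exactly at `L = 3`: lit-balaban `KIdx.hℓ : 4 ≤ ℓ`), `FluctuationComparisonRegPrIntL`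
(20520), (O‴χₛ), hence `YM3TorusSU2`, 19200, 19936 are NOT proved; closes 0∕3; embargo-lite №58 untouched (no `L = 3` expedition); rung R3 = SU(2) YM₃ on T³ — NOT d = 4,
NOT infinite volume, NOT a mass gap, NOT Clay; the Yang–Mills mass gap is NOT proved.  Sorry-free, axioms standard.

References: T. Bałaban, CMP **99** (1985) 75–102 [Balaban1985RegularSpaces] (Thm 2 p.83, (1.3)–(1.4) p.77); CMP **102** (1985) 255–275 [Balaban1985UV3] ((1)–(3) p.256,
(67)–(71) p.273); CMP **102** (1985) 277–309 [Balaban1985Variational] (Prop. 7 p.299); CMP **109** (1987) 249–301 [Balaban1987RG1] (§0 p.251).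
-/

set_option autoImplicit false

noncomputable section

namespace Summit.QuantumFields.YangMills.Theorems.YM3TorusSU2OfB8Thm2AtT3Members

open MeasureTheory
open scoped Matrix.Norms.L2Operator
open Literature.MathematicalPhysics.QuantumFieldTheory.Balaban1983to89
open Literature.MathematicalPhysics.QuantumFieldTheory.Balaban1983to89.T3ContinuumYM3Torus
open Literature.MathematicalPhysics.QuantumFieldTheory.Balaban1983to89.T3UnitLawDensityEML (ℰp)
open Literature.MathematicalPhysics.QuantumFieldTheory.Balaban1983to89.T3UnitScaleTilt
open Literature.MathematicalPhysics.QuantumFieldTheory.Balaban1983to89.T3PrintedRegularMinimiser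
open Literature.MathematicalPhysics.QuantumFieldTheory.Balaban1983to89.T3PrintedMinimiserExistence (Thm1GlobalMinAt)
open Literature.MathematicalPhysics.QuantumFieldTheory.Balaban1983to89.ExpMeanLog (deltaSU)
open Literature.MathematicalPhysics.QuantumFieldTheory.Balaban1983to89.T3YM3TorusStatement (YM3TorusSU2 YM3TorusSU2At)
open Literature.MathematicalPhysics.QuantumFieldTheory.Balaban1983to89.T3B8Thm2AtMembers (B8Thm2AtT3Members)
open Literature.MathematicalPhysics.QuantumFieldTheory.Balaban1985CMP102
open Literature.MathematicalPhysics.QuantumFieldTheory.Balaban1985CMP102.Setting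
open Summit.QuantumFields.Balaban3D.Carriers (suGroupModel)
open Summit.QuantumFields.Balaban3D.Proofs.Primitives (AlphaConsts)
open Summit.QuantumFields.Balaban3D.Proofs.Thresholds (Q0)
open B7Prop2Explicit (C0)
open Summit.QuantumFields.YangMills.Theses.UnitScaleTilt (FluctuationComparisonRegPrIntL HistoryTailL closes)
open Summit.QuantumFields.YangMills.Theorems
open Summit.QuantumFields.YangMills.Theorems.MinimiserStabilityRegPrOfB8Thm2AtT3Members (minimiserStabilityRegPr_of_b8Thm2AtT3Members exStub_of_b8Thm2AtT3Members)
open Summit.QuantumFields.YangMills.Theorems.HistoryTailOfExistenceMinimalOrbit (historyTailL_of_existenceMinimalOrbit_selXsV4DataRows_allL)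

/-- ★★★ **THE CRUX `HistoryTailL` (stmt-QuantumFields-19936) BY NAME ⟸ {`B8Thm2AtT3Members`, ⟨its registered NODE-O row `stub_selXsV4DataRows`, TYPE VERBATIM⟩}** — the
registry door ✓`historyTailL_of_existenceMinimalOrbit_selXsV4DataRows_allL` with its EX binder fed by ✓`exStub_of_b8Thm2AtT3Members`.  CONDITIONAL on both inputs.
[cite: Balaban1985RegularSpaces, Thm 2 p.83; Balaban1985UV3, (5) p.256 and (67)–(71) p.273; Balaban1985Variational, Prop. 7 p.299] -/
theorem historyTailL_of_b8Thm2AtT3Members_selXsV4DataRows (hX : B8Thm2AtT3Members)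
    (hrows : ∀ L : ℕ, Odd L → 1 < L → ∃ (B₀ A₀ A₁ : ℝ), 0 < A₀ ∧ 0 < A₁ ∧
      ∀ (B a₀ a₁ : ℝ), B₀ ≤ B → 1 ≤ 2 * B → 0 < a₀ → a₀ ≤ A₀ → 0 < a₁ → a₁ ≤ A₁ → B * a₁ ≤ a₀ →
        (143 * ((((3 + 4 : ℕ) : ℝ)) ^ 2 / 4) ^ 2) * (2 * (B * a₁)) ≤ 1 / 3 →
        2 * (2 * (B * a₁)) ≤ 2 * deltaSU (Fin 2) / (((3 + 4) * L : ℕ) : ℝ) ^ 2 →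
        Thm1GlobalMinAt L a₀ a₁ B →
        ∃ (b₁ p₁ : ℝ), ∀ (b₀ p₀ : ℝ), b₁ ≤ b₀ → p₁ ≤ p₀ →
          ∃ 𝔠 : AlphaConsts L (suGroupModel 2).N, 𝔠.b₀ = b₀ ∧ 𝔠.p₀ = p₀ ∧ 𝔠.B₃ = B ∧
            4 * 𝔠.B₃ * (L : ℝ) ^ 2 * avgWindowFactor L ≤ 𝔠.C68 ∧
            Real.exp (𝔠.p₀ - 1) ≤ 3 * C0 3 * 𝔠.C68 * (𝔠.b₀ * Q0 𝔠.p₀) ∧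
            (𝔠.b₀ * Q0 𝔠.p₀) * (2 * (L : ℝ) ^ 2 * avgWindowFactor L) ^ 2 ≤ 3 * C0 3 * 𝔠.C68 * a₁ ^ 2 ∧
            ∀ (F : T3Family) (hF : F.L = L),
              (∀ (γ : ℝ) (hγ : 0 < γ) (hγ1 : γ ≤ (min (hF ▸ 𝔠).gamma0 1) ^ 2) (K : ℕ),
                AlphaInputsT3AC.SmallFactor71OfRecT3 F (hF ▸ 𝔠) γ hγ hγ1 K) ∧
              ∀ (γ : ℝ) (hγ : 0 < γ) (hγ1 : γ ≤ (min (hF ▸ 𝔠).gamma0 1) ^ 2) (K : ℕ),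
                (∃ Ut : (k : ℕ) → GaugeField (F.P K) k (Matrix.specialUnitaryGroup (Fin 2) ℂ) →
                    GaugeField (F.P K) 0 (Matrix.specialUnitaryGroup (Fin 2) ℂ),
                  AlphaInputsT3AC.TrivMinimiserRowsT3 F (hF ▸ 𝔠) γ hγ hγ1 a₀ a₁ K Ut) →
                ∃ Ut : (k : ℕ) → GaugeField (F.P K) k (Matrix.specialUnitaryGroup (Fin 2) ℂ) →
                    GaugeField (F.P K) 0 (Matrix.specialUnitaryGroup (Fin 2) ℂ),
                  AlphaInputsT3AC.TrivMinimiserRowsT3 F (hF ▸ 𝔠) γ hγ hγ1 a₀ a₁ K Ut ∧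
                    AlphaInputsT3AC.DataRowsT3XsChiSel F (hF ▸ 𝔠) γ hγ hγ1 K Ut) :
    HistoryTailL :=
  historyTailL_of_existenceMinimalOrbit_selXsV4DataRows_allL (exStub_of_b8Thm2AtT3Members hX) hrows

/-- ★★★★ **THE RUNG LEAF OF RECORD FROM ONE NAMED LITERATURE FACT, THE SIBLING CRUX 20520 AND 19936's NODE-O ROW**:
`YM3TorusSU2 ⟸ {B8Thm2AtT3Members, FluctuationComparisonRegPrIntL, ⟨stub_selXsV4DataRows⟩}` — the route's `closes` with `h200` := ✓`minimiserStabilityRegPr_of_b8Thm2AtT3Members hX`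
and `hK2` := `historyTailL_of_b8Thm2AtT3Members_selXsV4DataRows hX hrows`; uniform `γ₁ = 1`.  CONDITIONAL on the three inputs; the first is an OPEN named fact (debt item).
[cite: Balaban1985RegularSpaces, Thm 2 p.83; Balaban1985UV3, (1)-(3) p.256 and (67)–(71) p.273; Balaban1987RG1, §0 p.251] -/
theorem ym3TorusSU2_of_b8Thm2AtT3Members_intL_selXsV4DataRows (hX : B8Thm2AtT3Members) (h201 : FluctuationComparisonRegPrIntL)
    (hrows : ∀ L : ℕ, Odd L → 1 < L → ∃ (B₀ A₀ A₁ : ℝ), 0 < A₀ ∧ 0 < A₁ ∧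
      ∀ (B a₀ a₁ : ℝ), B₀ ≤ B → 1 ≤ 2 * B → 0 < a₀ → a₀ ≤ A₀ → 0 < a₁ → a₁ ≤ A₁ → B * a₁ ≤ a₀ →
        (143 * ((((3 + 4 : ℕ) : ℝ)) ^ 2 / 4) ^ 2) * (2 * (B * a₁)) ≤ 1 / 3 →
        2 * (2 * (B * a₁)) ≤ 2 * deltaSU (Fin 2) / (((3 + 4) * L : ℕ) : ℝ) ^ 2 →
        Thm1GlobalMinAt L a₀ a₁ B →
        ∃ (b₁ p₁ : ℝ), ∀ (b₀ p₀ : ℝ), b₁ ≤ b₀ → p₁ ≤ p₀ →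
          ∃ 𝔠 : AlphaConsts L (suGroupModel 2).N, 𝔠.b₀ = b₀ ∧ 𝔠.p₀ = p₀ ∧ 𝔠.B₃ = B ∧
            4 * 𝔠.B₃ * (L : ℝ) ^ 2 * avgWindowFactor L ≤ 𝔠.C68 ∧
            Real.exp (𝔠.p₀ - 1) ≤ 3 * C0 3 * 𝔠.C68 * (𝔠.b₀ * Q0 𝔠.p₀) ∧
            (𝔠.b₀ * Q0 𝔠.p₀) * (2 * (L : ℝ) ^ 2 * avgWindowFactor L) ^ 2 ≤ 3 * C0 3 * 𝔠.C68 * a₁ ^ 2 ∧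
            ∀ (F : T3Family) (hF : F.L = L),
              (∀ (γ : ℝ) (hγ : 0 < γ) (hγ1 : γ ≤ (min (hF ▸ 𝔠).gamma0 1) ^ 2) (K : ℕ),
                AlphaInputsT3AC.SmallFactor71OfRecT3 F (hF ▸ 𝔠) γ hγ hγ1 K) ∧
              ∀ (γ : ℝ) (hγ : 0 < γ) (hγ1 : γ ≤ (min (hF ▸ 𝔠).gamma0 1) ^ 2) (K : ℕ),
                (∃ Ut : (k : ℕ) → GaugeField (F.P K) k (Matrix.specialUnitaryGroup (Fin 2) ℂ) →
                    GaugeField (F.P K) 0 (Matrix.specialUnitaryGroup (Fin 2) ℂ),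
                  AlphaInputsT3AC.TrivMinimiserRowsT3 F (hF ▸ 𝔠) γ hγ hγ1 a₀ a₁ K Ut) →
                ∃ Ut : (k : ℕ) → GaugeField (F.P K) k (Matrix.specialUnitaryGroup (Fin 2) ℂ) →
                    GaugeField (F.P K) 0 (Matrix.specialUnitaryGroup (Fin 2) ℂ),
                  AlphaInputsT3AC.TrivMinimiserRowsT3 F (hF ▸ 𝔠) γ hγ hγ1 a₀ a₁ K Ut ∧
                    AlphaInputsT3AC.DataRowsT3XsChiSel F (hF ▸ 𝔠) γ hγ hγ1 K Ut) :
    YM3TorusSU2 :=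
  closes (minimiserStabilityRegPr_of_b8Thm2AtT3Members hX) h201 (historyTailL_of_b8Thm2AtT3Members_selXsV4DataRows hX hrows)

/-- Every fixed-block leaf `YM3TorusSU2At L₀` from the same three inputs (lit ✓`YM3TorusSU2.at`). [cite: Balaban1985UV3, (1)-(3) p.256] -/
theorem ym3TorusSU2At_of_b8Thm2AtT3Members_intL_selXsV4DataRows (L₀ : ℕ) (hX : B8Thm2AtT3Members) (h201 : FluctuationComparisonRegPrIntL)
    (hrows : ∀ L : ℕ, Odd L → 1 < L → ∃ (B₀ A₀ A₁ : ℝ), 0 < A₀ ∧ 0 < A₁ ∧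
      ∀ (B a₀ a₁ : ℝ), B₀ ≤ B → 1 ≤ 2 * B → 0 < a₀ → a₀ ≤ A₀ → 0 < a₁ → a₁ ≤ A₁ → B * a₁ ≤ a₀ →
        (143 * ((((3 + 4 : ℕ) : ℝ)) ^ 2 / 4) ^ 2) * (2 * (B * a₁)) ≤ 1 / 3 →
        2 * (2 * (B * a₁)) ≤ 2 * deltaSU (Fin 2) / (((3 + 4) * L : ℕ) : ℝ) ^ 2 →
        Thm1GlobalMinAt L a₀ a₁ B →
        ∃ (b₁ p₁ : ℝ), ∀ (b₀ p₀ : ℝ), b₁ ≤ b₀ → p₁ ≤ p₀ →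
          ∃ 𝔠 : AlphaConsts L (suGroupModel 2).N, 𝔠.b₀ = b₀ ∧ 𝔠.p₀ = p₀ ∧ 𝔠.B₃ = B ∧
            4 * 𝔠.B₃ * (L : ℝ) ^ 2 * avgWindowFactor L ≤ 𝔠.C68 ∧
            Real.exp (𝔠.p₀ - 1) ≤ 3 * C0 3 * 𝔠.C68 * (𝔠.b₀ * Q0 𝔠.p₀) ∧
            (𝔠.b₀ * Q0 𝔠.p₀) * (2 * (L : ℝ) ^ 2 * avgWindowFactor L) ^ 2 ≤ 3 * C0 3 * 𝔠.C68 * a₁ ^ 2 ∧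
            ∀ (F : T3Family) (hF : F.L = L),
              (∀ (γ : ℝ) (hγ : 0 < γ) (hγ1 : γ ≤ (min (hF ▸ 𝔠).gamma0 1) ^ 2) (K : ℕ),
                AlphaInputsT3AC.SmallFactor71OfRecT3 F (hF ▸ 𝔠) γ hγ hγ1 K) ∧
              ∀ (γ : ℝ) (hγ : 0 < γ) (hγ1 : γ ≤ (min (hF ▸ 𝔠).gamma0 1) ^ 2) (K : ℕ),
                (∃ Ut : (k : ℕ) → GaugeField (F.P K) k (Matrix.specialUnitaryGroup (Fin 2) ℂ) →
                    GaugeField (F.P K) 0 (Matrix.specialUnitaryGroup (Fin 2) ℂ),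
                  AlphaInputsT3AC.TrivMinimiserRowsT3 F (hF ▸ 𝔠) γ hγ hγ1 a₀ a₁ K Ut) →
                ∃ Ut : (k : ℕ) → GaugeField (F.P K) k (Matrix.specialUnitaryGroup (Fin 2) ℂ) →
                    GaugeField (F.P K) 0 (Matrix.specialUnitaryGroup (Fin 2) ℂ),
                  AlphaInputsT3AC.TrivMinimiserRowsT3 F (hF ▸ 𝔠) γ hγ hγ1 a₀ a₁ K Ut ∧
                    AlphaInputsT3AC.DataRowsT3XsChiSel F (hF ▸ 𝔠) γ hγ hγ1 K Ut) :
    YM3TorusSU2At L₀ :=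
  (ym3TorusSU2_of_b8Thm2AtT3Members_intL_selXsV4DataRows hX h201 hrows).at L₀

end Summit.QuantumFields.YangMills.Theorems.YM3TorusSU2OfB8Thm2AtT3Members

end
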